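import Literature.AnabelianGeometry.EtaleTheta.Discharge.Sec5OfConstantsDictionary
import Literature.AnabelianGeometry.EtaleTheta.Discharge.Sec5HgcOfThetaSetting
import Literature.AnabelianGeometry.EtaleTheta.Discharge.Sec5TorsionRootsAreUnits
import Literature.AnabelianGeometry.EtaleTheta.Discharge.Sec5DKOfThetaSetting
import Literature.AnabelianGeometry.SemiGraphs.TemperedOpenMapping

/-!
# [EtTh] Lemma 5.9 (iv) "In particular" — `𝕄(𝔉)` IS a mod `N` mono-theta environment — for the §5 data OF THE SETTING with the honest
# `K^×`-part `DK`, from the ONE constants-dictionary binder (Lem 5.9 (iv) p.332 / PDF p.106; Lem 5.8 p.331; [IUTchII] Prop 1.2 (ii) `hM`)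

Mochizuki, *The étale theta function …*, Publ. RIMS **45** (2009), Lemma 5.9 (iv) p.332 (PDF p.106): "In particular, omitting the homomorphism
`s^⊔-Π_N` yields a mod `N` mono-theta environment"; Lemma 5.8 p.331 (PDF p.105).  [cite: MochizukiEtTh2009, Lem 5.9 (iv) p.332 (PDF p.106); Lem 5.8 p.331 (PDF p.105)]

abc-iut cell, layer L2, seat abc-iut-L2-t4 (§5 owner, gen 4), ROW W3-L2-01; PROOF-ONLY knit (no definition; nothing landed is edited) — the
SETTING INSTANTIATION of abc-iut-L2-t11's «CONSTANTS-DICTIONARY BUNDLE» (`ConstantsDictionary.lean` + `Discharge/Sec5OfConstantsDictionary.lean`,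
ruling R229: from ONE binder `hD : ConstantsDictionary α Cu μ hC hS ι m Cst ν̃` follow hgc / hsurj / hgeom / F-1306 / Lem 5.9 (iv) / Thm 5.10 (iii)
at `DK := kummerOut`, generic in `𝔉`) at this seat's §5 data OF THE SETTING `ThetaFrobenioid.ofThetaSettingData μ hC hS h Q R K' constEmb inj hinvc hinvp`
(p433549) with `ι := id`, `α := biratAutAction_ofConnectedTemperoidData hconst` (the natural birational action `B(Base(e⁻¹))^*`), where the
bundle's remaining Π-side / torsion binders are THEOREMS of this lineage:
* `hY := identifiesPiY_ofThetaSettingData` (𝔉.PiY = Π^tp_Y̲̲ = T.PiY via `ker_zquot`, `ofThetaSettingData_PiY` p438955);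
* `hYdd := identifiesPiYdd_ofThetaSettingData'` (Iff.rfl; abc-iut-f-125's p437488 has the same);
* `hopenX` («`Π^tp_X → G_K` open») := abc-iut-L3's `TemperedCurve.isOpenMap_augGK_of_isTempered` with the bridge parameters `e : GroupLevelData`
  (inline; the named form is `ThetaSetting.isOpenMap_augGK_mk_of_groupLevelData` of `IUT/HodgeArakelov/AbsTopMonoidsGenuineOfSettingTempered.lean`,
  not imported here to keep the layer order);
* `hK := kxRootNModCyclotome_ofThetaSettingData_of_constantsDictionary hD` — FULLY DISCHARGED: (hsurj) is `hD.hsurj`, the kernel clause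
  «`N`-torsion roots are units» is this seat's `h5` from the perfection of `Φ` (p437045);
* `DK := dkOfThetaSettingData … hconst hK = α.kummerOut hK` (p436491, rfl).
RESULTS: `identifiesPiY_ofThetaSettingData`, `kxRootNModCyclotome_ofThetaSettingData_of_constantsDictionary`,
`facts_ofThetaSettingYddData_of_constantsDictionary` (`Facts` ⟸ {`hconst`, `hD`}), and **`frdIsMonoThetaEnv_ofThetaSettingData_of_constantsDictionary`**:
the [IUTchII] Prop. 1.2 (ii) binder `hM` («`𝕄(𝔉)` is a mod-`N` mono-theta environment for `Π^tp_X̲̲[μ_N]` of the Setting») at the HONEST `DK`, with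
residual EXACTLY {`hD` (constants of `B_N` read in `ℚ̄_p`, Def 3.6 (iii)/(iv)), `hconst` (Def 3.6 (iii); theorem at the terminal shape, abc-iut-w4-d008),
the §5 named inputs `h1 h3 hsec hcs h8` / `H : Facts` (⟸ {hconst, hD} by the previous theorem), `hcompat` (F-0521 ⟺ θ := Θ̈, GAP G-L2t4-2),
`η ∈ thetaCocycles`} and the data (`tf`, `h`, roots, `m`, Setting parameters `e hC hS μ`).
HONEST FRAMING: kernel-checked composition of landed theorems; the dictionary is NOT constructed for an actual curve; nothing of [EtTh] is asserted
unconditionally; no side taken on [IUTchIII] Cor. 3.12; typed ≠ proved.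
-/

noncomputable section

namespace Literature.AnabelianGeometry.EtaleTheta

open CategoryTheory Opposite Literature.AlgebraicGeometry.Frobenioids Literature.AnabelianGeometry.SemiGraphs
  Literature.AnabelianGeometry.SemiGraphs.GaloisObjects Literature.AlgebraicGeometry.Frobenioids.QuasiTemperoid.BTempConnected

universe v₀

namespace ThetaFrobenioid

variable {p : ℕ} [Fact p.Prime] {D : ThetaSetting p} {E : D.EtaleThetaData} {l : ℕ} {C : E.DoubleUnderline l}
  {e : D.toTemperedCurve.GroupLevelData} {N : ℕ+} (μ : D.CyclotomeMod l N) (hC : D.Compat) (hS : D.Sec2Hyps)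
  {D₀ : Type} [Category.{v₀} D₀] {V : FrdIMonoidStub.{0}} {T₀ : RealifiedDivisorMonoids (D₀ := D₀) V}
  {VD : FrdICatStub.{1, 0, 0} (ConnectedPart (BTemp (C.temperedArithmeticGroup e).Pi))}
  {tf : TemperedFrobenioid T₀ (ConnectedPart (BTemp (C.temperedArithmeticGroup e).Pi)) VD} {hZ : tf.monoidType = MonoidType.Z}
  {hP : ∀ A : (ConnectedPart (BTemp (C.temperedArithmeticGroup e).Pi))ᵒᵖ, IsPerfect (tf.Φ.carrier A)}
  {NH : Subgroup (Field.absoluteGaloisGroup D.K) → tf.category → ℕ+ → Prop} {A₀ : tf.category}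
  {hA₀ : PreFrobenioid.IsFrobeniusTrivial tf.toElem A₀} {hA₀' : SemiGraphs.IsGaloisObj A₀.base.obj}
  {pullFrac : ∀ {A A' : (BiKummerSetting.mkOfConnectedTemperoid (C.temperedArithmeticGroup e) tf hZ hP NH A₀ hA₀ hA₀').C} (_ : A' ⟶ A),
    (BiKummerSetting.mkOfConnectedTemperoid (C.temperedArithmeticGroup e) tf hZ hP NH A₀ hA₀ hA₀').biratUnits A →
      (BiKummerSetting.mkOfConnectedTemperoid (C.temperedArithmeticGroup e) tf hZ hP NH A₀ hA₀ hA₀').biratUnits A'}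
  {θ : (BiKummerSetting.mkOfConnectedTemperoid (C.temperedArithmeticGroup e) tf hZ hP NH A₀ hA₀ hA₀').biratUnits
    (BiKummerSetting.mkOfConnectedTemperoid (C.temperedArithmeticGroup e) tf hZ hP NH A₀ hA₀ hA₀').Aodot}
  {Bl : (BiKummerSetting.mkOfConnectedTemperoid (C.temperedArithmeticGroup e) tf hZ hP NH A₀ hA₀ hA₀').C}
  {Pl : (BiKummerSetting.mkOfConnectedTemperoid (C.temperedArithmeticGroup e) tf hZ hP NH A₀ hA₀ hA₀').FractionPair θ Bl}
  {Rl : (BiKummerSetting.mkOfConnectedTemperoid (C.temperedArithmeticGroup e) tf hZ hP NH A₀ hA₀ hA₀').NthRoot θ Pl C.lPNat pullFrac}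
  (h : ModelFrobenioid.Hypotheses tf.divisorMonoid tf.ratFnFunctor)
  (Q : FrobenioidTheta.ThetaSubquotientStub.{0} (ConnectedPart (BTemp (C.temperedArithmeticGroup e).Pi)))
  (R : (BiKummerSetting.mkOfConnectedTemperoid (C.temperedArithmeticGroup e) tf hZ hP NH A₀ hA₀ hA₀').NthRoot Rl.root Rl.pair N pullFrac)
  (K' : Type) [Field K'] (constEmb : K'ˣ →* tf.biratUnitsModel R.BN) (constEmb_injective : Function.Injective constEmb)
  (hinvc : ∀ g : Aut R.AN.base,
    pull tf.divisorMonoid g.hom (ModelFrobenioid.div R.pair.num) = ModelFrobenioid.div R.pair.num)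
  (hinvp : ∀ y : (C.thetaEnvData μ hC hS).PiX, y ∈ (C.thetaEnvData μ hC hS).PiYdd →
    pull tf.divisorMonoid ((BiKummerSetting.mkOfConnectedTemperoid (C.temperedArithmeticGroup e) tf hZ hP NH A₀ hA₀ hA₀').galoisSurj
      R.AN.base R.αData.isGalois ((ContinuousMulEquiv.refl _) y)).hom (ModelFrobenioid.div R.pair.den) = ModelFrobenioid.div R.pair.den)

/-- **`IdentifiesPiY` for the §5 data of the Setting with `ι := id`**: `𝔉.PiY = Π^tp_Y̲̲ = T.PiY` (`ofThetaSettingData_PiY`, via `Ker(Π ↠ ℤ) = Π^tp_Y`).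
[cite: MochizukiEtTh2009, Lem 5.9 (iv) p.332 (PDF p.106)] -/
theorem identifiesPiY_ofThetaSettingData :
    (ofThetaSettingData μ hC hS h Q R K' constEmb constEmb_injective hinvc hinvp).IdentifiesPiY (C.thetaEnvData μ hC hS)
      (ContinuousMulEquiv.refl _).toMulEquiv := by
  intro y
  rw [ofThetaSettingData_PiY μ hC hS h Q R K' constEmb constEmb_injective hinvc hinvp]
  exact Iff.rfl

/-- **`IdentifiesPiYdd` for the §5 data of the Setting with `ι := id`** (on the nose: `𝔉.PiYdd = T.PiYdd`; cf. abc-iut-f-125's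
`identifiesPiYdd_ofThetaSettingData`).  [cite: MochizukiEtTh2009, Lem 5.9 (iv) p.332 (PDF p.106)] -/
theorem identifiesPiYdd_ofThetaSettingData' :
    (ofThetaSettingData μ hC hS h Q R K' constEmb constEmb_injective hinvc hinvp).IdentifiesPiYdd (C.thetaEnvData μ hC hS)
      (ContinuousMulEquiv.refl _).toMulEquiv :=
  fun _ => Iff.rfl

variable (hconst : ∀ (ε : Aut R.BN) (k : K'ˣ), tf.biratAutModel R.BN ε (constEmb k) = constEmb k)
  (m : (ofThetaSettingData μ hC hS h Q R K' constEmb constEmb_injective hinvc hinvp).muTorsion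
      (ofThetaSettingData μ hC hS h Q R K' constEmb constEmb_injective hinvc hinvp).BN N ≃* (C.thetaEnvData μ hC hS).mu)
  {Cst : Subgroup ((ofThetaSettingData μ hC hS h Q R K' constEmb constEmb_injective hinvc hinvp).biratUnits
      (ofThetaSettingData μ hC hS h Q R K' constEmb constEmb_injective hinvc hinvp).BN)}
  {ν' : Cst →* (PadicAlgCl p)ˣ}
  (hD : BiratAutAction.ConstantsDictionary
    (biratAutAction_ofConnectedTemperoidData (T := C.thetaEnvData μ hC hS) h Q C.odd_lPNat R (ContinuousMulEquiv.refl _) K' constEmb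
      constEmb_injective hinvc hinvp hconst) C μ hC hS (ContinuousMulEquiv.refl _) m Cst ν')

include hD in
/-- **`KxRootNModCyclotome` for the §5 data of the Setting from the ONE binder — FULLY DISCHARGED** ("`(K^×)^{1/N}/μ_N(B_N) ⥲ K^×`", Lemma 5.8):
surjectivity is `hD.hsurj`, the kernel clause is `h5` from the perfection of `Φ` (p437045).  [cite: MochizukiEtTh2009, Lem 5.8 p.331 (PDF p.105)] -/
theorem kxRootNModCyclotome_ofThetaSettingData_of_constantsDictionary :
    (ofThetaSettingData μ hC hS h Q R K' constEmb constEmb_injective hinvc hinvp).KxRootNModCyclotome :=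
  kxRootNModCyclotome_ofThetaSettingData_of_surj μ hC hS h Q R K' constEmb constEmb_injective hinvc hinvp hD.hsurj

/-- **`Facts` for the §5 data of the Setting (`A_⊙^bs := Ÿ̲̲`) from `hconst` and the ONE binder** (`hgc := hD.hgc`, `hH` a theorem).
[cite: MochizukiEtTh2009, §5 p.330–331 (PDF pp.104–105); Lem 5.8 p.331 (PDF p.105)] -/
theorem facts_ofThetaSettingYddData_of_constantsDictionary
    {pullFrac' : ∀ {A A' : (BiKummerSetting.mkOfThetaSettingYdd C e μ hC hS tf hZ hP NH).C} (_ : A' ⟶ A),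
      (BiKummerSetting.mkOfThetaSettingYdd C e μ hC hS tf hZ hP NH).biratUnits A →
        (BiKummerSetting.mkOfThetaSettingYdd C e μ hC hS tf hZ hP NH).biratUnits A'}
    {θ' : (BiKummerSetting.mkOfThetaSettingYdd C e μ hC hS tf hZ hP NH).biratUnits (BiKummerSetting.mkOfThetaSettingYdd C e μ hC hS tf hZ hP NH).Aodot}
    {Bl' : (BiKummerSetting.mkOfThetaSettingYdd C e μ hC hS tf hZ hP NH).C}
    {Pl' : (BiKummerSetting.mkOfThetaSettingYdd C e μ hC hS tf hZ hP NH).FractionPair θ' Bl'}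
    {Rl' : (BiKummerSetting.mkOfThetaSettingYdd C e μ hC hS tf hZ hP NH).NthRoot θ' Pl' C.lPNat pullFrac'}
    (R' : (BiKummerSetting.mkOfThetaSettingYdd C e μ hC hS tf hZ hP NH).NthRoot Rl'.root Rl'.pair N pullFrac')
    (constEmb' : K'ˣ →* tf.biratUnitsModel R'.BN) (constEmb_injective' : Function.Injective constEmb')
    (hinvc' : ∀ g : Aut R'.AN.base,
      pull tf.divisorMonoid g.hom (ModelFrobenioid.div R'.pair.num) = ModelFrobenioid.div R'.pair.num)
    (hinvp' : ∀ y : (C.thetaEnvData μ hC hS).PiX, y ∈ (C.thetaEnvData μ hC hS).PiYdd →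
      pull tf.divisorMonoid ((BiKummerSetting.mkOfThetaSettingYdd C e μ hC hS tf hZ hP NH).galoisSurj
        R'.AN.base R'.αData.isGalois ((ContinuousMulEquiv.refl _) y)).hom (ModelFrobenioid.div R'.pair.den) = ModelFrobenioid.div R'.pair.den)
    (hconst' : ∀ (ε : Aut R'.BN) (k : K'ˣ), tf.biratAutModel R'.BN ε (constEmb' k) = constEmb' k)
    (m' : (ofThetaSettingData μ hC hS h Q R' K' constEmb' constEmb_injective' hinvc' hinvp').muTorsion
        (ofThetaSettingData μ hC hS h Q R' K' constEmb' constEmb_injective' hinvc' hinvp').BN N ≃* (C.thetaEnvData μ hC hS).mu)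
    {Cst' : Subgroup ((ofThetaSettingData μ hC hS h Q R' K' constEmb' constEmb_injective' hinvc' hinvp').biratUnits
        (ofThetaSettingData μ hC hS h Q R' K' constEmb' constEmb_injective' hinvc' hinvp').BN)}
    {ν'' : Cst' →* (PadicAlgCl p)ˣ}
    (hD' : BiratAutAction.ConstantsDictionary
      (biratAutAction_ofConnectedTemperoidData (T := C.thetaEnvData μ hC hS) h Q C.odd_lPNat R' (ContinuousMulEquiv.refl _) K' constEmb'
        constEmb_injective' hinvc' hinvp' hconst') C μ hC hS (ContinuousMulEquiv.refl _) m' Cst' ν'') :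
    (ofThetaSettingData μ hC hS h Q R' K' constEmb' constEmb_injective' hinvc' hinvp').Facts :=
  facts_ofThetaSettingYddData μ hC hS h Q R' K' constEmb' constEmb_injective' hinvc' hinvp' hconst'
    (hD'.hgc (identifiesPiY_ofThetaSettingData μ hC hS h Q R' K' constEmb' constEmb_injective' hinvc' hinvp'))

include hD in
/-- **[EtTh] Lemma 5.9 (iv) "In particular" for the §5 data OF THE SETTING at the honest `DK`** — the [IUTchII] Prop. 1.2 (ii) binder `hM`
(«`𝕄(𝔉)` is a mod `N` mono-theta environment» for the Setting's `Π^tp_X̲̲[μ_N]`): abc-iut-L2-t11's `ConstantsDictionary.frdIsMonoThetaEnv_kummerOut` at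
`𝔉 := ofThetaSettingData`, `ι := id`, with `hY`, `hYdd`, `hopenX`, `hK` DISCHARGED by this lineage and `DK := dkOfConnectedTemperoidData … hconst hK` (= `dkOfThetaSettingData` for `A_⊙^bs := Ÿ̲̲`; `= α.kummerOut hK` by rfl).
[cite: MochizukiEtTh2009, Lem 5.9 (iv) p.332 (PDF p.106)] -/
theorem frdIsMonoThetaEnv_ofThetaSettingData_of_constantsDictionary
    (h1 : (ofThetaSettingData μ hC hS h Q R K' constEmb constEmb_injective hinvc hinvp).SectionsFactor)
    (h3 : (ofThetaSettingData μ hC hS h Q R K' constEmb constEmb_injective hinvc hinvp).OuterActionLZ)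
    (hsec : (ofThetaSettingData μ hC hS h Q R K' constEmb constEmb_injective hinvc hinvp).SgpCapSection)
    (hcs : (ofThetaSettingData μ hC hS h Q R K' constEmb constEmb_injective hinvc hinvp).SgpCupSection)
    (h8 : (ofThetaSettingData μ hC hS h Q R K' constEmb constEmb_injective hinvc hinvp).ConstantsEqNormalizer)
    (H : (ofThetaSettingData μ hC hS h Q R K' constEmb constEmb_injective hinvc hinvp).Facts)
    {η : (C.thetaEnvData μ hC hS).PiYdd → (C.thetaEnvData μ hC hS).mu} (hη : η ∈ (C.thetaEnvData μ hC hS).thetaCocycles)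
    (hcompat : (ofThetaSettingData μ hC hS h Q R K' constEmb constEmb_injective hinvc hinvp).ThetaSectionCompat H (C.thetaEnvData μ hC hS)
      (ContinuousMulEquiv.refl _).toMulEquiv m
      (identifiesPiYdd_ofThetaSettingData' μ hC hS h Q R K' constEmb constEmb_injective hinvc hinvp) η) :
    (ofThetaSettingData μ hC hS h Q R K' constEmb constEmb_injective hinvc hinvp).FrdIsMonoThetaEnv h1 h3 hsec hcs h8
      (dkOfConnectedTemperoidData (T := C.thetaEnvData μ hC hS) h Q C.odd_lPNat R (ContinuousMulEquiv.refl _) K' constEmb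
        constEmb_injective hinvc hinvp hconst
        (kxRootNModCyclotome_ofThetaSettingData_of_constantsDictionary μ hC hS h Q R K' constEmb constEmb_injective hinvc hinvp hconst m hD))
      (C.thetaEnvData μ hC hS) :=
  hD.frdIsMonoThetaEnv_kummerOut
    (kxRootNModCyclotome_ofThetaSettingData_of_constantsDictionary μ hC hS h Q R K' constEmb constEmb_injective hinvc hinvp hconst m hD)
    h1 h3 hsec hcs h8 H (identifiesPiY_ofThetaSettingData μ hC hS h Q R K' constEmb constEmb_injective hinvc hinvp)
    (identifiesPiYdd_ofThetaSettingData' μ hC hS h Q R K' constEmb constEmb_injective hinvc hinvp)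
    (by haveI := e.secondCountableTopology; exact D.toTemperedCurve.isOpenMap_augGK_of_isTempered e.isTempered) hη hcompat

end ThetaFrobenioid

end Literature.AnabelianGeometry.EtaleTheta

end
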